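import Mathlib.Algebra.Order.Field.Basic
import Mathlib.Algebra.BigOperators.Field
import Mathlib.Data.Finset.Card
import Mathlib.Tactic.Linarith
import Mathlib.Tactic.FieldSimp
import Mathlib.Tactic.IntervalCases
import Mathlib.Tactic.Positivity
import Mathlib.Tactic.Ring
import HarnessLib

/-!
# Hurwitz's signature bound: `2g₀ - 2 + Σᵢ (1 - 1/eᵢ) > 0 ⇒ ≥ 1/42`, hence `|G| ≤ 84(g - 1)`

Topic `NumberTheory/DiophantineGeometry` (companion of the Belyi-degree files; the input
"If `X` is a Galois Belyi curve, we have `deg_B(X) ≤ 84(g - 1)`" of [Javanpeykar2014, Cor. 1.5.1],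
`BelyiHeightBoundConstants.cor151_rows`). Hurwitz's theorem `|Aut(X)| ≤ 84(g - 1)` for a curve
of genus `g ≥ 2` consists of the Riemann–Hurwitz formula for the quotient map `X → X/G`,
`2g - 2 = |G| · (2g₀ - 2 + Σᵢ (1 - 1/eᵢ))` (`g₀` the genus of `X/G`, `eᵢ ≥ 2` the ramification
indices over the branch points), and the purely arithmetical fact that a positive value of
`μ = 2g₀ - 2 + Σᵢ (1 - 1/eᵢ)` is at least `1/42` (the signature `(0; 2, 3, 7)`). This file proves
the arithmetic (over `ℚ`):

* `inv_add_inv_add_inv_le` — **`1/a + 1/b + 1/c < 1 ⇒ 1/a + 1/b + 1/c ≤ 41/42`** for naturals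
  `a, b, c ≥ 2` (the hyperbolic triangle signatures; `inv_add_inv_add_inv_le_of_le` is the sorted
  case analysis);
* `hurwitz_signature_bound` — for any finite family `eᵢ ≥ 2` and `g₀ : ℕ`:
  `μ > 0 ⇒ μ ≥ 1/42` (cases `g₀ ≥ 2`, `g₀ = 1`, and `g₀ = 0` with `r ≥ 5`, `r = 4`, `r = 3`,
  `r ≤ 2` branch points);
* `card_le_of_riemannHurwitz_signature` — **`2g - 2 = N · μ`, `g ≥ 2` ⇒ `N ≤ 84 (g - 1)`**;
* the equality case: `inv_add_inv_add_inv_eq_iff` (`1/a + 1/b + 1/c = 41/42 ⟺ {a,b,c} = {2,3,7}`),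
  `hurwitz_signature_eq_iff` (`μ = 1/42 ⟺` the signature is `(0; 2, 3, 7)`) and
  `signature_of_card_eq` (`N = 84(g - 1)` forces the signature `(0; 2, 3, 7)` — Hurwitz groups are
  `(2,3,7)`-groups).

Not here: the Riemann–Hurwitz formula for Galois covers itself (the quotient of a function field
by a finite group of automorphisms and its ramification), hence not the statement
`|Aut(X)| ≤ 84(g - 1)` about curves. Theorems only; no definition, no named fact.

## References

* A. Hurwitz, *Über algebraische Gebilde mit eindeutigen Transformationen in sich*, Math. Ann. 41
  (1893), 403–442; H. M. Farkas, I. Kra, *Riemann Surfaces*, GTM 71, §V.1 (Hurwitz's theorem);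
  standard.
* A. Javanpeykar, *Polynomial bounds for Arakelov invariants of Belyi curves*, Algebra & Number
  Theory 8 (2014), §1.5, Cor. 1.5.1. [Javanpeykar2014]
-/

namespace Literature.NumberTheory.DiophantineGeometry

open Finset

/-! ### The triangle signatures: `1/a + 1/b + 1/c < 1 ⇒ ≤ 41/42` -/

/-- Ordered form: for naturals `2 ≤ a ≤ b ≤ c` with `1/a + 1/b + 1/c < 1` one has
`1/a + 1/b + 1/c ≤ 41/42` (equality for `(2, 3, 7)`). [folklore] -/
theorem inv_add_inv_add_inv_le_of_le {a b c : ℕ} (ha : 2 ≤ a) (hab : a ≤ b) (hbc : b ≤ c)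
    (hlt : (1 / a + 1 / b + 1 / c : ℚ) < 1) : (1 / a + 1 / b + 1 / c : ℚ) ≤ 41 / 42 := by
  have ha0 : (0 : ℚ) < a := by exact_mod_cast (by omega : 0 < a)
  have hb0 : (0 : ℚ) < b := by exact_mod_cast (by omega : 0 < b)
  have hc0 : (0 : ℚ) < c := by exact_mod_cast (by omega : 0 < c)
  -- `1/n ≤ 1/m` for `m ≤ n`
  have hinv : ∀ {m n : ℕ}, 0 < m → m ≤ n → (1 / n : ℚ) ≤ 1 / m := fun hm hmn ↦
    one_div_le_one_div_of_le (by exact_mod_cast hm) (by exact_mod_cast hmn)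
  rcases Nat.lt_or_ge a 4 with ha4 | ha4
  · interval_cases a
    · -- `a = 2`
      rcases Nat.lt_or_ge b 6 with hb6 | hb6
      · interval_cases b
        · -- `b = 2`: `1/2 + 1/2 + 1/c ≥ 1`, contradiction
          exfalso
          have : (0 : ℚ) < 1 / c := by positivity
          push_cast at hlt
          linarith
        · -- `b = 3`: `c ≥ 7`
          have hc7 : 7 ≤ c := by
            by_contra h
            have hc6 : c ≤ 6 := by omega
            have h6 : (1 / ((6 : ℕ) : ℚ)) ≤ 1 / c := hinv (by omega) hc6
            push_cast at hlt h6
            linarith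
          have h7 : (1 / c : ℚ) ≤ 1 / ((7 : ℕ) : ℚ) := hinv (by norm_num) hc7
          push_cast at hlt h7 ⊢
          linarith
        · -- `b = 4`: `c ≥ 5`
          have hc5 : 5 ≤ c := by
            by_contra h
            have hc4 : c ≤ 4 := by omega
            have h4 : (1 / ((4 : ℕ) : ℚ)) ≤ 1 / c := hinv (by omega) hc4
            push_cast at hlt h4
            linarith
          have h5 : (1 / c : ℚ) ≤ 1 / ((5 : ℕ) : ℚ) := hinv (by norm_num) hc5
          push_cast at hlt h5 ⊢
          linarith
        · -- `b = 5`: `c ≥ 5`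
          have h5 : (1 / c : ℚ) ≤ 1 / ((5 : ℕ) : ℚ) := hinv (by norm_num) hbc
          push_cast at hlt h5 ⊢
          linarith
      · -- `b ≥ 6`
        have hb : (1 / b : ℚ) ≤ 1 / ((6 : ℕ) : ℚ) := hinv (by norm_num) hb6
        have hc : (1 / c : ℚ) ≤ 1 / ((6 : ℕ) : ℚ) := hinv (by norm_num) (hb6.trans hbc)
        push_cast at hlt hb hc ⊢
        linarith
    · -- `a = 3`
      rcases Nat.lt_or_ge b 4 with hb4 | hb4
      · have hb3 : b = 3 := by omega
        subst hb3
        have hc4 : 4 ≤ c := by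
          by_contra h
          have hc3 : c = 3 := by omega
          subst hc3
          push_cast at hlt
          linarith
        have h4 : (1 / c : ℚ) ≤ 1 / ((4 : ℕ) : ℚ) := hinv (by norm_num) hc4
        push_cast at hlt h4 ⊢
        linarith
      · have hb : (1 / b : ℚ) ≤ 1 / ((4 : ℕ) : ℚ) := hinv (by norm_num) hb4
        have hc : (1 / c : ℚ) ≤ 1 / ((4 : ℕ) : ℚ) := hinv (by norm_num) (hb4.trans hbc)
        push_cast at hlt hb hc ⊢
        linarith
  · -- `a ≥ 4`
    have h1 : (1 / a : ℚ) ≤ 1 / ((4 : ℕ) : ℚ) := hinv (by norm_num) ha4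
    have h2 : (1 / b : ℚ) ≤ 1 / ((4 : ℕ) : ℚ) := hinv (by norm_num) (ha4.trans hab)
    have h3 : (1 / c : ℚ) ≤ 1 / ((4 : ℕ) : ℚ) := hinv (by norm_num) (ha4.trans (hab.trans hbc))
    push_cast at h1 h2 h3
    linarith

/-- **The hyperbolic triangle signatures.** For natural numbers `a, b, c ≥ 2` with
`1/a + 1/b + 1/c < 1`: `1/a + 1/b + 1/c ≤ 41/42`, with equality exactly for `{2, 3, 7}` —
the `(2,3,7)` triangle group is the hyperbolic triangle group of smallest co-area. [folklore] -/
theorem inv_add_inv_add_inv_le {a b c : ℕ} (ha : 2 ≤ a) (hb : 2 ≤ b) (hc : 2 ≤ c)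
    (hlt : (1 / a + 1 / b + 1 / c : ℚ) < 1) : (1 / a + 1 / b + 1 / c : ℚ) ≤ 41 / 42 := by
  -- sort the three numbers and apply the ordered form
  rcases le_total a b with hab | hba <;> rcases le_total b c with hbc | hcb <;>
    rcases le_total a c with hac | hca
  · linarith [inv_add_inv_add_inv_le_of_le ha hab hbc (by linarith)]
  · linarith [inv_add_inv_add_inv_le_of_le ha hab hbc (by linarith)]
  · -- `a ≤ c ≤ b`
    linarith [inv_add_inv_add_inv_le_of_le ha hac hcb (by linarith)]
  · -- `c ≤ a ≤ b`
    linarith [inv_add_inv_add_inv_le_of_le hc hca hab (by linarith)]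
  · -- `b ≤ a ≤ c`
    linarith [inv_add_inv_add_inv_le_of_le hb hba hac (by linarith)]
  · -- `b ≤ c ≤ a`
    linarith [inv_add_inv_add_inv_le_of_le hb hbc hca (by linarith)]
  · -- `c ≤ b ≤ a`, `a ≤ c`: all equal
    linarith [inv_add_inv_add_inv_le_of_le hc hcb hba (by linarith)]
  · -- `c ≤ b ≤ a`
    linarith [inv_add_inv_add_inv_le_of_le hc hcb hba (by linarith)]

/-! ### Hurwitz's signature bound -/

/-- **Hurwitz's signature bound.** For a "signature" `(g₀; e₁, …, e_r)` with all `eᵢ ≥ 2` and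
positive orbifold Euler characteristic `μ = 2g₀ - 2 + Σᵢ (1 - 1/eᵢ) > 0`, one has `μ ≥ 1/42`
(attained only by `(0; 2, 3, 7)`). This is the arithmetic of Hurwitz's theorem
`|Aut(X)| ≤ 84(g - 1)`: by the Riemann–Hurwitz formula for the quotient map `X → X/G` of a
curve of genus `g ≥ 2` by a group `G` of automorphisms, `2g - 2 = |G| · μ` for the signature of
the cover. [folklore] -/
theorem hurwitz_signature_bound {ι : Type*} (s : Finset ι) (e : ι → ℕ) (g₀ : ℕ)
    (he : ∀ i ∈ s, 2 ≤ e i)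
    (hpos : (0 : ℚ) < 2 * g₀ - 2 + ∑ i ∈ s, (1 - 1 / (e i : ℚ))) :
    (1 : ℚ) / 42 ≤ 2 * g₀ - 2 + ∑ i ∈ s, (1 - 1 / (e i : ℚ)) := by
  classical
  -- each term lies in `[1/2, 1)`
  have hterm : ∀ i ∈ s, (1 / 2 : ℚ) ≤ 1 - 1 / (e i : ℚ) ∧ 1 - 1 / (e i : ℚ) < 1 := by
    intro i hi
    have h2 : (2 : ℚ) ≤ e i := by exact_mod_cast he i hi
    have h0 : (0 : ℚ) < e i := by linarith
    constructor
    · have : (1 / (e i : ℚ)) ≤ 1 / 2 := one_div_le_one_div_of_le (by norm_num) h2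
      linarith
    · have : (0 : ℚ) < 1 / (e i : ℚ) := by positivity
      linarith
  have hsum_ge : (s.card : ℚ) / 2 ≤ ∑ i ∈ s, (1 - 1 / (e i : ℚ)) := by
    have h := Finset.sum_le_sum fun i hi ↦ (hterm i hi).1
    rw [Finset.sum_const, nsmul_eq_mul] at h
    linarith
  have hsum_lt : ∀ hs : s.Nonempty, ∑ i ∈ s, (1 - 1 / (e i : ℚ)) < s.card := by
    intro hs
    have h := Finset.sum_lt_sum_of_nonempty hs fun i hi ↦ (hterm i hi).2
    rwa [Finset.sum_const, nsmul_eq_mul, mul_one] at h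
  rcases Nat.lt_or_ge g₀ 1 with hg | hg
  · -- `g₀ = 0`
    have hg0 : g₀ = 0 := by omega
    subst hg0
    simp only [Nat.cast_zero, mul_zero, zero_sub] at hpos ⊢
    -- `r = |s| ≥ 3`
    have hcard3 : 3 ≤ s.card := by
      by_contra h
      have hle : s.card ≤ 2 := by omega
      rcases s.eq_empty_or_nonempty with hs | hs
      · subst hs; simp at hpos; linarith
      · have := hsum_lt hs
        have : (s.card : ℚ) ≤ 2 := by exact_mod_cast hle
        linarith
    rcases Nat.lt_or_ge s.card 5 with h5 | h5
    · rcases Nat.lt_or_ge s.card 4 with h4 | h4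
      · -- `r = 3`
        have hcard : s.card = 3 := by omega
        obtain ⟨x, y, z, hxy, hxz, hyz, hs⟩ := Finset.card_eq_three.mp hcard
        subst hs
        have hx := he x (by simp)
        have hy := he y (by simp)
        have hz := he z (by simp)
        rw [Finset.sum_insert (by simp [hxy, hxz]), Finset.sum_insert (by simp [hyz]),
          Finset.sum_singleton] at hpos ⊢
        have hlt : (1 / (e x) + 1 / (e y) + 1 / (e z) : ℚ) < 1 := by linarith
        have := inv_add_inv_add_inv_le hx hy hz hlt
        linarith
      · -- `r = 4`: some `e_j ≥ 3`
        have hcard : s.card = 4 := by omega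
        have hex : ∃ j ∈ s, 3 ≤ e j := by
          by_contra h
          push Not at h
          have hall : ∀ i ∈ s, (1 - 1 / (e i : ℚ)) = 1 / 2 := by
            intro i hi
            have : e i = 2 := by have := he i hi; have := h i hi; omega
            rw [this]; norm_num
          rw [Finset.sum_congr rfl hall, Finset.sum_const, nsmul_eq_mul, hcard] at hpos
          norm_num at hpos
        obtain ⟨j, hj, hj3⟩ := hex
        have hj3' : (3 : ℚ) ≤ e j := by exact_mod_cast hj3
        have htj : (2 / 3 : ℚ) ≤ 1 - 1 / (e j : ℚ) := by
          have : (1 / (e j : ℚ)) ≤ 1 / 3 := one_div_le_one_div_of_le (by norm_num) hj3'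
          linarith
        have hcard3 : (s.erase j).card = 3 := by rw [Finset.card_erase_of_mem hj, hcard]
        have hrest : (3 : ℚ) / 2 ≤ ∑ i ∈ s.erase j, (1 - 1 / (e i : ℚ)) := by
          have h := Finset.sum_le_sum (s := s.erase j)
            fun i hi ↦ (hterm i (Finset.mem_of_mem_erase hi)).1
          rw [Finset.sum_const, nsmul_eq_mul, hcard3] at h
          push_cast at h
          linarith
        rw [← Finset.add_sum_erase s _ hj] at hpos ⊢
        linarith
    · -- `r ≥ 5`
      have : (5 : ℚ) ≤ s.card := by exact_mod_cast h5
      linarith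
  · rcases Nat.lt_or_ge g₀ 2 with hg2 | hg2
    · -- `g₀ = 1`: `s` non-empty
      have hg1 : g₀ = 1 := by omega
      subst hg1
      simp only [Nat.cast_one, mul_one] at hpos ⊢
      have hs : s.Nonempty := by
        rw [Finset.nonempty_iff_ne_empty]
        rintro rfl
        simp at hpos
      have h1 : (1 : ℚ) ≤ s.card := by exact_mod_cast Finset.card_pos.mpr hs
      linarith
    · -- `g₀ ≥ 2`
      have : (2 : ℚ) ≤ g₀ := by exact_mod_cast hg2
      have h0 : (0 : ℚ) ≤ ∑ i ∈ s, (1 - 1 / (e i : ℚ)) :=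
        Finset.sum_nonneg fun i hi ↦ by linarith [(hterm i hi).1]
      linarith

/-- **Hurwitz's bound `|G| ≤ 84 (g - 1)`** from the Riemann–Hurwitz relation
`2g - 2 = |G| · (2g₀ - 2 + Σᵢ (1 - 1/eᵢ))` of a Galois cover of signature `(g₀; e₁, …, e_r)`
(`eᵢ ≥ 2`) with `g ≥ 2`. In particular a Galois Belyi curve `X` (signature `(0; e₁, e₂, e₃)`
for `X → X/Aut(X) ≅ ℙ¹`) has `deg_B(X) ≤ |Aut(X)| ≤ 84(g - 1)`, the input of
[cite: Javanpeykar2014, Cor. 1.5.1]. [folklore] -/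
theorem card_le_of_riemannHurwitz_signature {ι : Type*} (s : Finset ι) (e : ι → ℕ) (g₀ : ℕ)
    (he : ∀ i ∈ s, 2 ≤ e i) {N g : ℕ} (hg : 2 ≤ g)
    (hRH : (2 * g - 2 : ℚ) = N * (2 * g₀ - 2 + ∑ i ∈ s, (1 - 1 / (e i : ℚ)))) :
    N ≤ 84 * (g - 1) := by
  set μ : ℚ := 2 * g₀ - 2 + ∑ i ∈ s, (1 - 1 / (e i : ℚ)) with hμ
  have hg' : (2 : ℚ) ≤ g := by exact_mod_cast hg
  have hN0 : 0 < N := by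
    rcases Nat.eq_zero_or_pos N with h | h
    · rw [h, Nat.cast_zero, zero_mul] at hRH; linarith
    · exact h
  have hN' : (0 : ℚ) < N := by exact_mod_cast hN0
  have hμpos : 0 < μ := by
    by_contra h
    have : (N : ℚ) * μ ≤ 0 := mul_nonpos_of_nonneg_of_nonpos hN'.le (not_lt.mp h)
    linarith
  have hμ42 := hurwitz_signature_bound s e g₀ he hμpos
  have h : (N : ℚ) ≤ 84 * (g - 1) := by nlinarith
  have h' : (N : ℚ) ≤ ((84 * (g - 1) : ℕ) : ℚ) := by
    rw [Nat.cast_mul, Nat.cast_sub (by omega)]; push_cast; linarith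
  exact_mod_cast h'

/-! ### The equality case: `(2, 3, 7)` -/

/-- Ordered equality case: for `2 ≤ a ≤ b ≤ c` with `1/a + 1/b + 1/c = 41/42`,
`(a, b, c) = (2, 3, 7)`. [folklore] -/
theorem eq_two_three_seven_of_le {a b c : ℕ} (ha : 2 ≤ a) (hab : a ≤ b) (hbc : b ≤ c)
    (heq : (1 / a + 1 / b + 1 / c : ℚ) = 41 / 42) : a = 2 ∧ b = 3 ∧ c = 7 := by
  have ha0 : (0 : ℚ) < a := by exact_mod_cast (by omega : 0 < a)
  have hb0 : (0 : ℚ) < b := by exact_mod_cast (by omega : 0 < b)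
  have hc0 : (0 : ℚ) < c := by exact_mod_cast (by omega : 0 < c)
  have hinv : ∀ {m n : ℕ}, 0 < m → m ≤ n → (1 / n : ℚ) ≤ 1 / m := fun hm hmn ↦
    one_div_le_one_div_of_le (by exact_mod_cast hm) (by exact_mod_cast hmn)
  -- `a = 2`
  have ha2 : a = 2 := by
    by_contra h3
    have h3' : 3 ≤ a := by omega
    rcases Nat.lt_or_ge a 4 with ha4 | ha4
    · have ha3 : a = 3 := by omega
      subst ha3
      -- `1/b + 1/c ≤ 7/12 < 41/42 - 1/3`
      rcases Nat.lt_or_ge b 4 with hb4 | hb4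
      · have hb3 : b = 3 := by omega
        subst hb3
        rcases Nat.lt_or_ge c 4 with hc4 | hc4
        · have hc3 : c = 3 := by omega
          subst hc3; norm_num at heq
        · have h4 : (1 / c : ℚ) ≤ 1 / ((4 : ℕ) : ℚ) := hinv (by norm_num) hc4
          push_cast at heq h4; linarith
      · have hb : (1 / b : ℚ) ≤ 1 / ((4 : ℕ) : ℚ) := hinv (by norm_num) hb4
        have hc : (1 / c : ℚ) ≤ 1 / ((4 : ℕ) : ℚ) := hinv (by norm_num) (hb4.trans hbc)
        push_cast at heq hb hc; linarith
    · have h1 : (1 / a : ℚ) ≤ 1 / ((4 : ℕ) : ℚ) := hinv (by norm_num) ha4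
      have h2 : (1 / b : ℚ) ≤ 1 / ((4 : ℕ) : ℚ) := hinv (by norm_num) (ha4.trans hab)
      have h3 : (1 / c : ℚ) ≤ 1 / ((4 : ℕ) : ℚ) := hinv (by norm_num) (ha4.trans (hab.trans hbc))
      push_cast at h1 h2 h3; linarith
  subst ha2
  -- `b = 3`
  have hb3 : b = 3 := by
    rcases Nat.lt_or_ge b 6 with hb6 | hb6
    · interval_cases b
      · exfalso
        have : (0 : ℚ) < 1 / c := by positivity
        push_cast at heq; linarith
      · rfl
      · exfalso
        have hc5 : 5 ≤ c := by
          by_contra h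
          have hc4 : c = 4 := by omega
          subst hc4; norm_num at heq
        have h5 : (1 / c : ℚ) ≤ 1 / ((5 : ℕ) : ℚ) := hinv (by norm_num) hc5
        push_cast at heq h5; linarith
      · exfalso
        have h5 : (1 / c : ℚ) ≤ 1 / ((5 : ℕ) : ℚ) := hinv (by norm_num) hbc
        push_cast at heq h5; linarith
    · exfalso
      have hb : (1 / b : ℚ) ≤ 1 / ((6 : ℕ) : ℚ) := hinv (by norm_num) hb6
      have hc : (1 / c : ℚ) ≤ 1 / ((6 : ℕ) : ℚ) := hinv (by norm_num) (hb6.trans hbc)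
      push_cast at heq hb hc; linarith
  subst hb3
  -- `c = 7`
  have hc7 : (c : ℚ) = 7 := by
    push_cast at heq
    field_simp at heq
    linarith
  exact ⟨rfl, rfl, by exact_mod_cast hc7⟩

/-- **Equality in the triangle bound**: for `a, b, c ≥ 2`, `1/a + 1/b + 1/c = 41/42` iff
`{a, b, c} = {2, 3, 7}`. [folklore] -/
theorem inv_add_inv_add_inv_eq_iff {a b c : ℕ} (ha : 2 ≤ a) (hb : 2 ≤ b) (hc : 2 ≤ c) :
    (1 / a + 1 / b + 1 / c : ℚ) = 41 / 42 ↔ ({a, b, c} : Multiset ℕ) = {2, 3, 7} := by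
  constructor
  · intro heq
    have perm : ∀ u v w : ℕ,
        ({u, v, w} : Multiset ℕ) = {v, u, w} ∧ ({u, v, w} : Multiset ℕ) = {u, w, v} :=
      fun u v w ↦ ⟨Multiset.cons_swap u v {w}, congr_arg (u ::ₘ ·) (Multiset.cons_swap v w 0)⟩
    rcases le_total a b with hab | hba <;> rcases le_total b c with hbc | hcb <;>
      rcases le_total a c with hac | hca
    · obtain ⟨rfl, rfl, rfl⟩ := eq_two_three_seven_of_le ha hab hbc heq; rfl
    · obtain ⟨rfl, rfl, rfl⟩ := eq_two_three_seven_of_le ha hab hbc heq; rfl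
    · obtain ⟨rfl, rfl, rfl⟩ := eq_two_three_seven_of_le ha hac hcb (by linarith)
      exact (perm 2 7 3).2
    · obtain ⟨rfl, rfl, rfl⟩ := eq_two_three_seven_of_le hc hca hab (by linarith)
      exact ((perm 3 7 2).2.trans (perm 3 2 7).1)
    · obtain ⟨rfl, rfl, rfl⟩ := eq_two_three_seven_of_le hb hba hac (by linarith)
      exact (perm 3 2 7).1
    · obtain ⟨rfl, rfl, rfl⟩ := eq_two_three_seven_of_le hb hbc hca (by linarith)
      exact ((perm 7 2 3).1.trans (perm 2 7 3).2)
    · obtain ⟨rfl, rfl, rfl⟩ := eq_two_three_seven_of_le hc hcb hba (by linarith)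
      exact (((perm 7 3 2).2.trans (perm 7 2 3).1).trans (perm 2 7 3).2)
    · obtain ⟨rfl, rfl, rfl⟩ := eq_two_three_seven_of_le hc hcb hba (by linarith)
      exact (((perm 7 3 2).2.trans (perm 7 2 3).1).trans (perm 2 7 3).2)
  · intro h
    have e1 : ((({a, b, c} : Multiset ℕ).map fun u : ℕ ↦ (1 / (u : ℚ))).sum) =
        (({2, 3, 7} : Multiset ℕ).map fun u : ℕ ↦ (1 / (u : ℚ))).sum := by rw [h]
    simp only [Multiset.insert_eq_cons, Multiset.map_cons, Multiset.map_singleton,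
      Multiset.sum_cons, Multiset.sum_singleton] at e1
    push_cast at e1
    linarith

/-- **Equality in Hurwitz's signature bound**: `μ = 2g₀ - 2 + Σᵢ (1 - 1/eᵢ) = 1/42` (all `eᵢ ≥ 2`)
holds exactly for the signature `(0; 2, 3, 7)`: `g₀ = 0`, three branch indices, `{eᵢ} = {2, 3, 7}`.
[folklore] -/
theorem hurwitz_signature_eq_iff {ι : Type*} [DecidableEq ι] (s : Finset ι) (e : ι → ℕ) (g₀ : ℕ)
    (he : ∀ i ∈ s, 2 ≤ e i) :
    (2 * g₀ - 2 + ∑ i ∈ s, (1 - 1 / (e i : ℚ)) = (1 : ℚ) / 42) ↔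
      g₀ = 0 ∧ s.card = 3 ∧ s.val.map e = {2, 3, 7} := by
  classical
  -- each term lies in `[1/2, 1)`
  have hterm : ∀ i ∈ s, (1 / 2 : ℚ) ≤ 1 - 1 / (e i : ℚ) ∧ 1 - 1 / (e i : ℚ) < 1 := by
    intro i hi
    have h2 : (2 : ℚ) ≤ e i := by exact_mod_cast he i hi
    have h0 : (0 : ℚ) < e i := by linarith
    constructor
    · have : (1 / (e i : ℚ)) ≤ 1 / 2 := one_div_le_one_div_of_le (by norm_num) h2
      linarith
    · have : (0 : ℚ) < 1 / (e i : ℚ) := by positivity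
      linarith
  have hsum_ge : (s.card : ℚ) / 2 ≤ ∑ i ∈ s, (1 - 1 / (e i : ℚ)) := by
    have h := Finset.sum_le_sum fun i hi ↦ (hterm i hi).1
    rw [Finset.sum_const, nsmul_eq_mul] at h
    linarith
  have hsum_lt : ∀ hs : s.Nonempty, ∑ i ∈ s, (1 - 1 / (e i : ℚ)) < s.card := by
    intro hs
    have h := Finset.sum_lt_sum_of_nonempty hs fun i hi ↦ (hterm i hi).2
    rwa [Finset.sum_const, nsmul_eq_mul, mul_one] at h
  have h0 : (0 : ℚ) ≤ ∑ i ∈ s, (1 - 1 / (e i : ℚ)) :=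
    Finset.sum_nonneg fun i hi ↦ by linarith [(hterm i hi).1]
  constructor
  · intro hμ
    -- `g₀ = 0`
    have hg : g₀ = 0 := by
      by_contra hg
      have h1 : (1 : ℚ) ≤ g₀ := by exact_mod_cast Nat.one_le_iff_ne_zero.2 hg
      rcases s.eq_empty_or_nonempty with hs | hs
      · subst hs
        simp only [Finset.sum_empty, add_zero] at hμ
        rcases Nat.lt_or_ge g₀ 2 with hg2 | hg2
        · have : g₀ = 1 := by omega
          subst this; norm_num at hμ
        · have : (2 : ℚ) ≤ g₀ := by exact_mod_cast hg2
          linarith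
      · have := hsum_ge
        have hc : (1 : ℚ) ≤ s.card := by exact_mod_cast Finset.card_pos.mpr hs
        linarith
    subst hg
    simp only [Nat.cast_zero, mul_zero, zero_sub] at hμ
    -- `3 ≤ r ≤ 4`, then `r = 3`
    have hcard3 : 3 ≤ s.card := by
      by_contra h
      have hle : s.card ≤ 2 := by omega
      rcases s.eq_empty_or_nonempty with hs | hs
      · subst hs; simp at hμ; linarith
      · have := hsum_lt hs
        have : (s.card : ℚ) ≤ 2 := by exact_mod_cast hle
        linarith
    have hcard4 : s.card ≤ 4 := by
      by_contra h
      have : (5 : ℚ) ≤ s.card := by exact_mod_cast (by omega : 5 ≤ s.card)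
      linarith
    have hcard : s.card = 3 := by
      by_contra hne
      have hcard' : s.card = 4 := by omega
      -- `r = 4`: `μ ≥ 1/6`
      have hex : ∃ j ∈ s, 3 ≤ e j := by
        by_contra h
        push Not at h
        have hall : ∀ i ∈ s, (1 - 1 / (e i : ℚ)) = 1 / 2 := by
          intro i hi
          have : e i = 2 := by have := he i hi; have := h i hi; omega
          rw [this]; norm_num
        rw [Finset.sum_congr rfl hall, Finset.sum_const, nsmul_eq_mul, hcard'] at hμ
        norm_num at hμ
      obtain ⟨j, hj, hj3⟩ := hex
      have hj3' : (3 : ℚ) ≤ e j := by exact_mod_cast hj3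
      have htj : (2 / 3 : ℚ) ≤ 1 - 1 / (e j : ℚ) := by
        have : (1 / (e j : ℚ)) ≤ 1 / 3 := one_div_le_one_div_of_le (by norm_num) hj3'
        linarith
      have hcard3' : (s.erase j).card = 3 := by rw [Finset.card_erase_of_mem hj, hcard']
      have hrest : (3 : ℚ) / 2 ≤ ∑ i ∈ s.erase j, (1 - 1 / (e i : ℚ)) := by
        have h := Finset.sum_le_sum (s := s.erase j)
          fun i hi ↦ (hterm i (Finset.mem_of_mem_erase hi)).1
        rw [Finset.sum_const, nsmul_eq_mul, hcard3'] at h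
        push_cast at h
        linarith
      rw [← Finset.add_sum_erase s _ hj] at hμ
      linarith
    -- `r = 3`: the triangle equality case
    obtain ⟨x, y, z, hxy, hxz, hyz, hs⟩ := Finset.card_eq_three.mp hcard
    subst hs
    have hx := he x (by simp)
    have hy := he y (by simp)
    have hz := he z (by simp)
    rw [Finset.sum_insert (by simp [hxy, hxz]), Finset.sum_insert (by simp [hyz]),
      Finset.sum_singleton] at hμ
    have heq : (1 / (e x) + 1 / (e y) + 1 / (e z) : ℚ) = 41 / 42 := by linarith
    refine ⟨rfl, hcard, ?_⟩
    have hm := (inv_add_inv_add_inv_eq_iff hx hy hz).1 heq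
    rw [← hm]
    simp [Finset.insert_val, Multiset.ndinsert_of_notMem, hxy, hxz, hyz]
  · rintro ⟨rfl, hcard, hmap⟩
    simp only [Nat.cast_zero, mul_zero, zero_sub]
    have hsum : ∑ i ∈ s, (1 / (e i : ℚ)) = 41 / 42 := by
      have h1 : ∑ i ∈ s, (1 / (e i : ℚ)) =
          ((s.val.map e).map fun u : ℕ ↦ (1 / (u : ℚ))).sum := by
        rw [Finset.sum_eq_multiset_sum, Multiset.map_map]; rfl
      rw [h1, hmap]
      simp only [Multiset.insert_eq_cons, Multiset.map_cons, Multiset.map_singleton,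
        Multiset.sum_cons, Multiset.sum_singleton]
      norm_num
    rw [Finset.sum_sub_distrib, Finset.sum_const, nsmul_eq_mul, hcard, hsum]
    norm_num

/-- **The Hurwitz equality case `N = 84 (g - 1)` forces the signature `(0; 2, 3, 7)`.**
[folklore] -/
theorem signature_of_card_eq {ι : Type*} [DecidableEq ι] (s : Finset ι) (e : ι → ℕ) (g₀ : ℕ)
    (he : ∀ i ∈ s, 2 ≤ e i) {N g : ℕ} (hg : 2 ≤ g)
    (hRH : (2 * g - 2 : ℚ) = N * (2 * g₀ - 2 + ∑ i ∈ s, (1 - 1 / (e i : ℚ))))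
    (hN : N = 84 * (g - 1)) : g₀ = 0 ∧ s.card = 3 ∧ s.val.map e = {2, 3, 7} := by
  refine (hurwitz_signature_eq_iff s e g₀ he).1 ?_
  have hg' : (2 : ℚ) ≤ g := by exact_mod_cast hg
  have hN' : (N : ℚ) = 84 * (g - 1) := by
    rw [hN, Nat.cast_mul, Nat.cast_sub (by omega)]; push_cast; ring
  rw [hN'] at hRH
  have hpos : (0 : ℚ) < 84 * (g - 1) := by linarith
  have h1 : (84 * ((g : ℚ) - 1)) * (2 * g₀ - 2 + ∑ i ∈ s, (1 - 1 / (e i : ℚ))) =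
      (84 * ((g : ℚ) - 1)) * (1 / 42) := by linarith
  exact mul_left_cancel₀ hpos.ne' h1

end Literature.NumberTheory.DiophantineGeometry
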